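import Summits.ValiantsHypothesis.ValiantsHypothesis.Theorems.LacunarySymmetroidMatrixDescartesZeroChangeStateDefs
import HarnessLib

/-!
# LINE (A) `product_plus_one` — r = 1 rung, state space: the ρ-ELIMINATION of ΩLC for EVERY k (pen THEOREM E∞, step 1)

Crux item stmt-ValiantsHypothesis-18050 (`MatrixDescartes`), LINE (A) `Lines/product_plus_one.lean` (skeleton 4c66814e33f05045), floor
`OneChangeFloorK3`, r = 1 rung in crit-1 g11's state-space vocabulary (`…ZeroChangeStateDefs`).  Source: pen val-idea-25 g9 NOTE §56.23 /
§56.24 (THEOREM E∞, ρ-elimination; scripts `abprobe/s59/omlc/omlc_general.py`, `omlc_powersum.py`; crit-1 #434 / crit-6 #105 PASS),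
re-derived here in AGGREGATE coordinates, for every number `k` of rows at once.

For a feasible state write `e_i = E i` (row means), `y_i = ρ(ρ−1)·π i ≥ 0` (EXCESS VARIANCES: the row variance is `e_i − e_i² + y_i`),
and the eight aggregates `P_n = Σ e_iⁿ` (`n ≤ 4`), `Y₀ = Σ y_i`, `Y₁ = Σ y_i e_i`, `Y₂ = Σ y_i e_i²`, `W₀ = Σ y_i²`.  Then (`bk1_eq` … `bk4_eq`,
support identity `μ_{j+2} = (1+ρ)μ_{j+1} − ρμ_j` of the letters `{0,1,ρ}`):
`κ₁ = P₁`, `κ₂ = P₁ − P₂ + Y₀`, `κ₃ = ρY₀ + Y₀ − 3Y₁ + 2P₃ − 3P₂ + P₁`,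
`κ₄ = ρ²Y₀ + ρ(Y₀ − 4Y₁) + Y₀ − 10Y₁ + 12Y₂ − 3W₀ − 6P₄ + 12P₃ − 7P₂ + P₁`; hence (`sOmega_eq`, `sOmega1_eq`, `sOmega2_eq`)
`Ω = Y₀ − P₂ − P₁²` (so `Y₀ = CAP = Ω + ψ² + Σe²`), `Ω′ = Y₀·ρ + β`, `Ω″ = Y₀·ρ² + γ·ρ + δ` with ρ-FREE aggregates `β, γ, δ`, and
`Z₀ := Ω′² − Ω·Ω″ = Aρ² + Bρ + C` with `A = Y₀(P₁² + P₂)`, `4AC − B² = Ω·G` for an explicit ρ-free polynomial `G` of 63 terms in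
`(P₁..P₄, Ω, Y₁, Y₂, W₀)` (`omegaLC_discriminant_identity`: `4A·Z₀ = (2Aρ + B)² + Ω·G`, `ring`).  CONSEQUENCE (`OmegaLogConcave_of_GPos`):
for every `k`, crit-1's `OmegaLogConcave k` (ΩLC, Conjecture E) FOLLOWS from the ρ-free positivity `G > 0` on feasible states with `Ω > 0`
— the pen's steps (2)–(5) of THEOREM E∞ (simplex-Bernstein aggregation + vertex/edge charging certificates), formalised separately.

No `def`, no named fact, no sorry.  HONEST FRAMING: a reduction step of the r = 1 rung programme; ΩLC for `k ≥ 3` is NOT proved in this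
file; nothing here closes `stub_oneChangeFloorK3` or any stub of LINE (A); 18050 / `MatrixDescartes` OPEN; `VP ≠ VNP` is NOT proved.
-/

set_option linter.dupNamespace false

namespace Summit.ValiantsHypothesis.ValiantsHypothesis.Theorems.LacunarySymmetroidMatrixDescartes

namespace ZeroChangeState

open Finset
open scoped BigOperators

variable {k : ℕ}

/-- `κ₁ = P₁ = Σ e_i`. -/
theorem bk1_eq (ρ : ℝ) (E π : Fin k → ℝ) : bk1 ρ E π = ∑ i, E i := by
  unfold bk1 rowMoment
  exact Finset.sum_congr rfl (fun i _ => by ring)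

/-- `κ₂ = P₁ − P₂ + Y₀` (row variance `= e − e² + y`, `y = ρ(ρ−1)π` the excess variance). -/
theorem bk2_eq (ρ : ℝ) (E π : Fin k → ℝ) :
    bk2 ρ E π = ∑ i, E i - ∑ i, E i ^ 2 + ∑ i, ρ * (ρ - 1) * π i := by
  unfold bk2 rowMoment
  rw [← Finset.sum_sub_distrib, ← Finset.sum_add_distrib]
  exact Finset.sum_congr rfl (fun i _ => by ring)

/-- `κ₃ = ρY₀ + Y₀ − 3Y₁ + 2P₃ − 3P₂ + P₁` (third cumulants of the rows via the support identity). -/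
theorem bk3_eq (ρ : ℝ) (E π : Fin k → ℝ) :
    bk3 ρ E π = ρ * ∑ i, ρ * (ρ - 1) * π i + ∑ i, ρ * (ρ - 1) * π i - 3 * ∑ i, ρ * (ρ - 1) * π i * E i
      + 2 * ∑ i, E i ^ 3 - 3 * ∑ i, E i ^ 2 + ∑ i, E i := by
  unfold bk3 rowMoment
  simp only [Finset.mul_sum, ← Finset.sum_sub_distrib, ← Finset.sum_add_distrib]
  exact Finset.sum_congr rfl (fun i _ => by ring)

/-- `κ₄ = ρ²Y₀ + ρ(Y₀ − 4Y₁) + Y₀ − 10Y₁ + 12Y₂ − 3W₀ − 6P₄ + 12P₃ − 7P₂ + P₁` (fourth cumulants via the support identity). -/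
theorem bk4_eq (ρ : ℝ) (E π : Fin k → ℝ) :
    bk4 ρ E π = ρ ^ 2 * ∑ i, ρ * (ρ - 1) * π i + ρ * ∑ i, ρ * (ρ - 1) * π i - 4 * ρ * ∑ i, ρ * (ρ - 1) * π i * E i
      + ∑ i, ρ * (ρ - 1) * π i - 10 * ∑ i, ρ * (ρ - 1) * π i * E i + 12 * ∑ i, ρ * (ρ - 1) * π i * E i ^ 2
      - 3 * ∑ i, (ρ * (ρ - 1) * π i) ^ 2 - 6 * ∑ i, E i ^ 4 + 12 * ∑ i, E i ^ 3 - 7 * ∑ i, E i ^ 2 + ∑ i, E i := by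
  unfold bk4 rowMoment
  simp only [Finset.mul_sum, ← Finset.sum_sub_distrib, ← Finset.sum_add_distrib]
  exact Finset.sum_congr rfl (fun i _ => by ring)

/-- `Ω = Y₀ − P₂ − P₁²` in aggregate coordinates (so `Y₀ = CAP = Ω + ψ² + Σ e_i²`, pen §56.24 (2)). -/
theorem sOmega_eq (ρ : ℝ) (E π : Fin k → ℝ) (P1 P2 Y0 : ℝ) (hP1 : P1 = ∑ i, E i) (hP2 : P2 = ∑ i, E i ^ 2)
    (hY0 : Y0 = ∑ i, ρ * (ρ - 1) * π i) : sOmega ρ E π = Y0 - P2 - P1 ^ 2 := by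
  unfold sOmega; rw [bk1_eq, bk2_eq, hP1, hP2, hY0]; ring

/-- `Ω′ = Y₀·ρ + β` with the ρ-free aggregate `β = −2P₁Y₀ + 2P₁P₂ − 2P₁² − 3Y₁ + 2P₃ − 2P₂` (pen §56.23 (F1): `Ω′ = CAP·ρ + β`). -/
theorem sOmega1_eq (ρ : ℝ) (E π : Fin k → ℝ) (P1 P2 P3 Y0 Y1 : ℝ) (hP1 : P1 = ∑ i, E i) (hP2 : P2 = ∑ i, E i ^ 2)
    (hP3 : P3 = ∑ i, E i ^ 3) (hY0 : Y0 = ∑ i, ρ * (ρ - 1) * π i) (hY1 : Y1 = ∑ i, ρ * (ρ - 1) * π i * E i) :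
    sOmega1 ρ E π = Y0 * ρ + (-2 * P1 * Y0 + 2 * P1 * P2 - 2 * P1 ^ 2 - 3 * Y1 + 2 * P3 - 2 * P2) := by
  unfold sOmega1; rw [bk1_eq, bk2_eq, bk3_eq, hP1, hP2, hP3, hY0, hY1]; ring

/-- `Ω″ = Y₀·ρ² + γ·ρ + δ` with the ρ-free aggregates `γ = −2P₁Y₀ − 4Y₁`,
`δ = −2Y₀² + 4P₂Y₀ − 2P₂² + 6P₁Y₁ − 6P₁Y₀ − 4P₁P₃ + 10P₁P₂ − 4P₁² − 3W₀ + 12Y₂ − 7Y₁ − 6P₄ + 10P₃ − 4P₂` (pen §56.23 (F2)). -/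
theorem sOmega2_eq (ρ : ℝ) (E π : Fin k → ℝ) (P1 P2 P3 P4 Y0 Y1 Y2 W0 : ℝ) (hP1 : P1 = ∑ i, E i)
    (hP2 : P2 = ∑ i, E i ^ 2) (hP3 : P3 = ∑ i, E i ^ 3) (hP4 : P4 = ∑ i, E i ^ 4) (hY0 : Y0 = ∑ i, ρ * (ρ - 1) * π i)
    (hY1 : Y1 = ∑ i, ρ * (ρ - 1) * π i * E i) (hY2 : Y2 = ∑ i, ρ * (ρ - 1) * π i * E i ^ 2)
    (hW0 : W0 = ∑ i, (ρ * (ρ - 1) * π i) ^ 2) :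
    sOmega2 ρ E π = Y0 * ρ ^ 2 + (-2 * P1 * Y0 - 4 * Y1) * ρ
      + (-2 * Y0 ^ 2 + 4 * P2 * Y0 - 2 * P2 ^ 2 + 6 * P1 * Y1 - 6 * P1 * Y0 - 4 * P1 * P3 + 10 * P1 * P2 - 4 * P1 ^ 2
          - 3 * W0 + 12 * Y2 - 7 * Y1 - 6 * P4 + 10 * P3 - 4 * P2) := by
  unfold sOmega2; rw [bk1_eq, bk2_eq, bk3_eq, bk4_eq, hP1, hP2, hP3, hP4, hY0, hY1, hY2, hW0]; ring

set_option maxHeartbeats 4000000 in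
/-- **THE ρ-ELIMINATION IDENTITY** (pen §56.23/§56.24 (1), aggregate form, pure real algebra): with `Ω = Y₀ − P₂ − P₁²`,
`Ω′ = Y₀ρ + β`, `Ω″ = Y₀ρ² + γρ + δ` as above, `A = Y₀(P₁² + P₂)` and
`B = −2P₁³Y₀ − 2P₁Y₀² + 2P₁P₂Y₀ − 4P₁²Y₁ − 4P₁²Y₀ − 2Y₀Y₁ + 4P₃Y₀ − 4P₂Y₁ − 4P₂Y₀`:
`4A·(Ω′² − Ω·Ω″) = (2Aρ + B)² + Ω·G`, `G` the explicit ρ-free polynomial (63 terms) printed in the statement. -/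
theorem omegaLC_discriminant_identity (r P1 P2 P3 P4 Om Y0 Y1 Y2 W0 : ℝ) (hOm : Om = Y0 - P2 - P1 ^ 2) :
    4 * (Y0 * (P1 ^ 2 + P2))
        * ((Y0 * r + (-2 * P1 * Y0 + 2 * P1 * P2 - 2 * P1 ^ 2 - 3 * Y1 + 2 * P3 - 2 * P2)) ^ 2
          - Om * (Y0 * r ^ 2 + (-2 * P1 * Y0 - 4 * Y1) * r
            + (-2 * Y0 ^ 2 + 4 * P2 * Y0 - 2 * P2 ^ 2 + 6 * P1 * Y1 - 6 * P1 * Y0 - 4 * P1 * P3 + 10 * P1 * P2 - 4 * P1 ^ 2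
                - 3 * W0 + 12 * Y2 - 7 * Y1 - 6 * P4 + 10 * P3 - 4 * P2)))
      = (2 * (Y0 * (P1 ^ 2 + P2)) * r
          + (-2 * P1 ^ 3 * Y0 - 2 * P1 * Y0 ^ 2 + 2 * P1 * P2 * Y0 - 4 * P1 ^ 2 * Y1 - 4 * P1 ^ 2 * Y0 - 2 * Y0 * Y1
              + 4 * P3 * Y0 - 4 * P2 * Y1 - 4 * P2 * Y0)) ^ 2
        + Om * ((8 : ℝ) * P1 ^ 8 + (20 : ℝ) * P1 ^ 6 * Om + (32 : ℝ) * P1 ^ 6 * P2 + (8 : ℝ) * P1 ^ 7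
      + (16 : ℝ) * P1 ^ 4 * Om ^ 2 + (64 : ℝ) * P1 ^ 4 * P2 * Om + (24 : ℝ) * P1 ^ 4 * P2 ^ 2
      + (-16 : ℝ) * P1 ^ 5 * Y1 + (16 : ℝ) * P1 ^ 5 * Om + (32 : ℝ) * P1 ^ 5 * P3 + (16 : ℝ) * P1 ^ 5 * P2
      + (4 : ℝ) * P1 ^ 2 * Om ^ 3 + (40 : ℝ) * P1 ^ 2 * P2 * Om ^ 2 + (28 : ℝ) * P1 ^ 2 * P2 ^ 2 * Om
      + (-24 : ℝ) * P1 ^ 3 * Om * Y1 + (8 : ℝ) * P1 ^ 3 * Om ^ 2 + (48 : ℝ) * P1 ^ 3 * P3 * Om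
      + (-16 : ℝ) * P1 ^ 3 * P2 * Y1 + (24 : ℝ) * P1 ^ 3 * P2 * Om + (32 : ℝ) * P1 ^ 3 * P2 * P3
      + (8 : ℝ) * P1 ^ 3 * P2 ^ 2 + (12 : ℝ) * P1 ^ 4 * W0 + (-48 : ℝ) * P1 ^ 4 * Y2 + (12 : ℝ) * P1 ^ 4 * Y1
      + (24 : ℝ) * P1 ^ 4 * P4 + (-8 : ℝ) * P1 ^ 4 * P3 + (8 : ℝ) * P2 * Om ^ 3 + (8 : ℝ) * P2 ^ 2 * Om ^ 2
      + (-8 : ℝ) * P1 * Om ^ 2 * Y1 + (16 : ℝ) * P1 * P3 * Om ^ 2 + (-8 : ℝ) * P1 * P2 * Om * Y1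
      + (8 : ℝ) * P1 * P2 * Om ^ 2 + (16 : ℝ) * P1 * P2 * P3 * Om + (8 : ℝ) * P1 * P2 ^ 2 * Om
      + (12 : ℝ) * P1 ^ 2 * Y1 ^ 2 + (12 : ℝ) * P1 ^ 2 * Om * W0 + (-48 : ℝ) * P1 ^ 2 * Om * Y2
      + (12 : ℝ) * P1 ^ 2 * Om * Y1 + (24 : ℝ) * P1 ^ 2 * P4 * Om + (16 : ℝ) * P1 ^ 2 * P3 * Y1
      + (-8 : ℝ) * P1 ^ 2 * P3 * Om + (-16 : ℝ) * P1 ^ 2 * P3 ^ 2 + (24 : ℝ) * P1 ^ 2 * P2 * W0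
      + (-96 : ℝ) * P1 ^ 2 * P2 * Y2 + (24 : ℝ) * P1 ^ 2 * P2 * Y1 + (48 : ℝ) * P1 ^ 2 * P2 * P4
      + (-16 : ℝ) * P1 ^ 2 * P2 * P3 + (-4 : ℝ) * Om * Y1 ^ 2 + (16 : ℝ) * P3 * Om * Y1
      + (-16 : ℝ) * P3 ^ 2 * Om + (12 : ℝ) * P2 * Y1 ^ 2 + (12 : ℝ) * P2 * Om * W0 + (-48 : ℝ) * P2 * Om * Y2
      + (12 : ℝ) * P2 * Om * Y1 + (24 : ℝ) * P2 * P4 * Om + (16 : ℝ) * P2 * P3 * Y1 + (-8 : ℝ) * P2 * P3 * Om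
      + (-16 : ℝ) * P2 * P3 ^ 2 + (12 : ℝ) * P2 ^ 2 * W0 + (-48 : ℝ) * P2 ^ 2 * Y2 + (12 : ℝ) * P2 ^ 2 * Y1
      + (24 : ℝ) * P2 ^ 2 * P4 + (-8 : ℝ) * P2 ^ 2 * P3) := by
  subst hOm
  ring

set_option maxHeartbeats 4000000 in
/-- **REDUCTION (every `k`): ΩLC follows from the positivity of the ρ-free aggregate `G`.**  If at every feasible state with `Ω > 0`
(`ρ > 1`) the polynomial `G(P₁..P₄, Ω, Y₁, Y₂, W₀)` of `omegaLC_discriminant_identity` is positive (aggregates of `e_i = E i`,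
`y_i = ρ(ρ−1)π i`), then crit-1's `OmegaLogConcave k` holds.  (`A = Y₀(P₁²+P₂) ≥ 0`; if `A = 0` the identity degenerates and the
conclusion is read off from `B² ≤ …` — handled below by cases.)  This is step (1) of pen THEOREM E∞ (§56.24) in the kernel, for every `k`. -/
theorem OmegaLogConcave_of_GPos (k : ℕ)
    (hG : ∀ (ρ : ℝ) (E π : Fin k → ℝ), 1 < ρ → Feasible ρ E π → 0 < sOmega ρ E π →
      0 < (8 : ℝ) * (∑ i, E i) ^ 8 + (20 : ℝ) * (∑ i, E i) ^ 6 * (sOmega ρ E π)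
        + (32 : ℝ) * (∑ i, E i) ^ 6 * (∑ i, E i ^ 2) + (8 : ℝ) * (∑ i, E i) ^ 7
        + (16 : ℝ) * (∑ i, E i) ^ 4 * (sOmega ρ E π) ^ 2
        + (64 : ℝ) * (∑ i, E i) ^ 4 * (∑ i, E i ^ 2) * (sOmega ρ E π)
        + (24 : ℝ) * (∑ i, E i) ^ 4 * (∑ i, E i ^ 2) ^ 2
        + (-16 : ℝ) * (∑ i, E i) ^ 5 * (∑ i, ρ * (ρ - 1) * π i * E i)
        + (16 : ℝ) * (∑ i, E i) ^ 5 * (sOmega ρ E π) + (32 : ℝ) * (∑ i, E i) ^ 5 * (∑ i, E i ^ 3)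
        + (16 : ℝ) * (∑ i, E i) ^ 5 * (∑ i, E i ^ 2) + (4 : ℝ) * (∑ i, E i) ^ 2 * (sOmega ρ E π) ^ 3
        + (40 : ℝ) * (∑ i, E i) ^ 2 * (∑ i, E i ^ 2) * (sOmega ρ E π) ^ 2
        + (28 : ℝ) * (∑ i, E i) ^ 2 * (∑ i, E i ^ 2) ^ 2 * (sOmega ρ E π)
        + (-24 : ℝ) * (∑ i, E i) ^ 3 * (sOmega ρ E π) * (∑ i, ρ * (ρ - 1) * π i * E i)
        + (8 : ℝ) * (∑ i, E i) ^ 3 * (sOmega ρ E π) ^ 2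
        + (48 : ℝ) * (∑ i, E i) ^ 3 * (∑ i, E i ^ 3) * (sOmega ρ E π)
        + (-16 : ℝ) * (∑ i, E i) ^ 3 * (∑ i, E i ^ 2) * (∑ i, ρ * (ρ - 1) * π i * E i)
        + (24 : ℝ) * (∑ i, E i) ^ 3 * (∑ i, E i ^ 2) * (sOmega ρ E π)
        + (32 : ℝ) * (∑ i, E i) ^ 3 * (∑ i, E i ^ 2) * (∑ i, E i ^ 3)
        + (8 : ℝ) * (∑ i, E i) ^ 3 * (∑ i, E i ^ 2) ^ 2
        + (12 : ℝ) * (∑ i, E i) ^ 4 * (∑ i, (ρ * (ρ - 1) * π i) ^ 2)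
        + (-48 : ℝ) * (∑ i, E i) ^ 4 * (∑ i, ρ * (ρ - 1) * π i * E i ^ 2)
        + (12 : ℝ) * (∑ i, E i) ^ 4 * (∑ i, ρ * (ρ - 1) * π i * E i)
        + (24 : ℝ) * (∑ i, E i) ^ 4 * (∑ i, E i ^ 4) + (-8 : ℝ) * (∑ i, E i) ^ 4 * (∑ i, E i ^ 3)
        + (8 : ℝ) * (∑ i, E i ^ 2) * (sOmega ρ E π) ^ 3 + (8 : ℝ) * (∑ i, E i ^ 2) ^ 2 * (sOmega ρ E π) ^ 2
        + (-8 : ℝ) * (∑ i, E i) * (sOmega ρ E π) ^ 2 * (∑ i, ρ * (ρ - 1) * π i * E i)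
        + (16 : ℝ) * (∑ i, E i) * (∑ i, E i ^ 3) * (sOmega ρ E π) ^ 2
        + (-8 : ℝ) * (∑ i, E i) * (∑ i, E i ^ 2) * (sOmega ρ E π) * (∑ i, ρ * (ρ - 1) * π i * E i)
        + (8 : ℝ) * (∑ i, E i) * (∑ i, E i ^ 2) * (sOmega ρ E π) ^ 2
        + (16 : ℝ) * (∑ i, E i) * (∑ i, E i ^ 2) * (∑ i, E i ^ 3) * (sOmega ρ E π)
        + (8 : ℝ) * (∑ i, E i) * (∑ i, E i ^ 2) ^ 2 * (sOmega ρ E π)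
        + (12 : ℝ) * (∑ i, E i) ^ 2 * (∑ i, ρ * (ρ - 1) * π i * E i) ^ 2
        + (12 : ℝ) * (∑ i, E i) ^ 2 * (sOmega ρ E π) * (∑ i, (ρ * (ρ - 1) * π i) ^ 2)
        + (-48 : ℝ) * (∑ i, E i) ^ 2 * (sOmega ρ E π) * (∑ i, ρ * (ρ - 1) * π i * E i ^ 2)
        + (12 : ℝ) * (∑ i, E i) ^ 2 * (sOmega ρ E π) * (∑ i, ρ * (ρ - 1) * π i * E i)
        + (24 : ℝ) * (∑ i, E i) ^ 2 * (∑ i, E i ^ 4) * (sOmega ρ E π)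
        + (16 : ℝ) * (∑ i, E i) ^ 2 * (∑ i, E i ^ 3) * (∑ i, ρ * (ρ - 1) * π i * E i)
        + (-8 : ℝ) * (∑ i, E i) ^ 2 * (∑ i, E i ^ 3) * (sOmega ρ E π)
        + (-16 : ℝ) * (∑ i, E i) ^ 2 * (∑ i, E i ^ 3) ^ 2
        + (24 : ℝ) * (∑ i, E i) ^ 2 * (∑ i, E i ^ 2) * (∑ i, (ρ * (ρ - 1) * π i) ^ 2)
        + (-96 : ℝ) * (∑ i, E i) ^ 2 * (∑ i, E i ^ 2) * (∑ i, ρ * (ρ - 1) * π i * E i ^ 2)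
        + (24 : ℝ) * (∑ i, E i) ^ 2 * (∑ i, E i ^ 2) * (∑ i, ρ * (ρ - 1) * π i * E i)
        + (48 : ℝ) * (∑ i, E i) ^ 2 * (∑ i, E i ^ 2) * (∑ i, E i ^ 4)
        + (-16 : ℝ) * (∑ i, E i) ^ 2 * (∑ i, E i ^ 2) * (∑ i, E i ^ 3)
        + (-4 : ℝ) * (sOmega ρ E π) * (∑ i, ρ * (ρ - 1) * π i * E i) ^ 2
        + (16 : ℝ) * (∑ i, E i ^ 3) * (sOmega ρ E π) * (∑ i, ρ * (ρ - 1) * π i * E i)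
        + (-16 : ℝ) * (∑ i, E i ^ 3) ^ 2 * (sOmega ρ E π)
        + (12 : ℝ) * (∑ i, E i ^ 2) * (∑ i, ρ * (ρ - 1) * π i * E i) ^ 2
        + (12 : ℝ) * (∑ i, E i ^ 2) * (sOmega ρ E π) * (∑ i, (ρ * (ρ - 1) * π i) ^ 2)
        + (-48 : ℝ) * (∑ i, E i ^ 2) * (sOmega ρ E π) * (∑ i, ρ * (ρ - 1) * π i * E i ^ 2)
        + (12 : ℝ) * (∑ i, E i ^ 2) * (sOmega ρ E π) * (∑ i, ρ * (ρ - 1) * π i * E i)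
        + (24 : ℝ) * (∑ i, E i ^ 2) * (∑ i, E i ^ 4) * (sOmega ρ E π)
        + (16 : ℝ) * (∑ i, E i ^ 2) * (∑ i, E i ^ 3) * (∑ i, ρ * (ρ - 1) * π i * E i)
        + (-8 : ℝ) * (∑ i, E i ^ 2) * (∑ i, E i ^ 3) * (sOmega ρ E π)
        + (-16 : ℝ) * (∑ i, E i ^ 2) * (∑ i, E i ^ 3) ^ 2
        + (12 : ℝ) * (∑ i, E i ^ 2) ^ 2 * (∑ i, (ρ * (ρ - 1) * π i) ^ 2)
        + (-48 : ℝ) * (∑ i, E i ^ 2) ^ 2 * (∑ i, ρ * (ρ - 1) * π i * E i ^ 2)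
        + (12 : ℝ) * (∑ i, E i ^ 2) ^ 2 * (∑ i, ρ * (ρ - 1) * π i * E i)
        + (24 : ℝ) * (∑ i, E i ^ 2) ^ 2 * (∑ i, E i ^ 4) + (-8 : ℝ) * (∑ i, E i ^ 2) ^ 2 * (∑ i, E i ^ 3)) :
    OmegaLogConcave k := by
  intro ρ hρ E π hF hΩ
  have hGpos := hG ρ E π hρ hF hΩ
  -- aggregates
  set P1 : ℝ := ∑ i, E i with hP1
  set P2 : ℝ := ∑ i, E i ^ 2 with hP2
  set P3 : ℝ := ∑ i, E i ^ 3 with hP3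
  set P4 : ℝ := ∑ i, E i ^ 4 with hP4
  set Y0 : ℝ := ∑ i, ρ * (ρ - 1) * π i with hY0
  set Y1 : ℝ := ∑ i, ρ * (ρ - 1) * π i * E i with hY1
  set Y2 : ℝ := ∑ i, ρ * (ρ - 1) * π i * E i ^ 2 with hY2
  set W0 : ℝ := ∑ i, (ρ * (ρ - 1) * π i) ^ 2 with hW0
  have hΩeq : sOmega ρ E π = Y0 - P2 - P1 ^ 2 := sOmega_eq ρ E π P1 P2 Y0 hP1 hP2 hY0
  have h1 := sOmega1_eq ρ E π P1 P2 P3 Y0 Y1 hP1 hP2 hP3 hY0 hY1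
  have h2 := sOmega2_eq ρ E π P1 P2 P3 P4 Y0 Y1 Y2 W0 hP1 hP2 hP3 hP4 hY0 hY1 hY2 hW0
  have hid := omegaLC_discriminant_identity ρ P1 P2 P3 P4 (sOmega ρ E π) Y0 Y1 Y2 W0 hΩeq
  rw [hΩeq] at hGpos
  -- `A = Y0 (P1² + P2) > 0`: `Y0 = Ω + P2 + P1² > 0` and `P1² + P2 > 0` (else `Ω = Y0 − 0 ≤ `… contradiction handled by nlinarith)
  have hP2nn : 0 ≤ P2 := by rw [hP2]; exact Finset.sum_nonneg (fun i _ => sq_nonneg (E i))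
  have hY0pos : 0 < Y0 := by nlinarith [sq_nonneg P1]
  have hΩG : 0 < (Y0 - P2 - P1 ^ 2) * ((8 : ℝ) * P1 ^ 8 + (20 : ℝ) * P1 ^ 6 * (Y0 - P2 - P1 ^ 2) + (32 : ℝ) * P1 ^ 6 * P2 + (8 : ℝ) * P1 ^ 7
        + (16 : ℝ) * P1 ^ 4 * (Y0 - P2 - P1 ^ 2) ^ 2 + (64 : ℝ) * P1 ^ 4 * P2 * (Y0 - P2 - P1 ^ 2)
        + (24 : ℝ) * P1 ^ 4 * P2 ^ 2 + (-16 : ℝ) * P1 ^ 5 * Y1 + (16 : ℝ) * P1 ^ 5 * (Y0 - P2 - P1 ^ 2)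
        + (32 : ℝ) * P1 ^ 5 * P3 + (16 : ℝ) * P1 ^ 5 * P2 + (4 : ℝ) * P1 ^ 2 * (Y0 - P2 - P1 ^ 2) ^ 3
        + (40 : ℝ) * P1 ^ 2 * P2 * (Y0 - P2 - P1 ^ 2) ^ 2 + (28 : ℝ) * P1 ^ 2 * P2 ^ 2 * (Y0 - P2 - P1 ^ 2)
        + (-24 : ℝ) * P1 ^ 3 * (Y0 - P2 - P1 ^ 2) * Y1 + (8 : ℝ) * P1 ^ 3 * (Y0 - P2 - P1 ^ 2) ^ 2
        + (48 : ℝ) * P1 ^ 3 * P3 * (Y0 - P2 - P1 ^ 2) + (-16 : ℝ) * P1 ^ 3 * P2 * Y1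
        + (24 : ℝ) * P1 ^ 3 * P2 * (Y0 - P2 - P1 ^ 2) + (32 : ℝ) * P1 ^ 3 * P2 * P3 + (8 : ℝ) * P1 ^ 3 * P2 ^ 2
        + (12 : ℝ) * P1 ^ 4 * W0 + (-48 : ℝ) * P1 ^ 4 * Y2 + (12 : ℝ) * P1 ^ 4 * Y1 + (24 : ℝ) * P1 ^ 4 * P4
        + (-8 : ℝ) * P1 ^ 4 * P3 + (8 : ℝ) * P2 * (Y0 - P2 - P1 ^ 2) ^ 3
        + (8 : ℝ) * P2 ^ 2 * (Y0 - P2 - P1 ^ 2) ^ 2 + (-8 : ℝ) * P1 * (Y0 - P2 - P1 ^ 2) ^ 2 * Y1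
        + (16 : ℝ) * P1 * P3 * (Y0 - P2 - P1 ^ 2) ^ 2 + (-8 : ℝ) * P1 * P2 * (Y0 - P2 - P1 ^ 2) * Y1
        + (8 : ℝ) * P1 * P2 * (Y0 - P2 - P1 ^ 2) ^ 2 + (16 : ℝ) * P1 * P2 * P3 * (Y0 - P2 - P1 ^ 2)
        + (8 : ℝ) * P1 * P2 ^ 2 * (Y0 - P2 - P1 ^ 2) + (12 : ℝ) * P1 ^ 2 * Y1 ^ 2
        + (12 : ℝ) * P1 ^ 2 * (Y0 - P2 - P1 ^ 2) * W0 + (-48 : ℝ) * P1 ^ 2 * (Y0 - P2 - P1 ^ 2) * Y2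
        + (12 : ℝ) * P1 ^ 2 * (Y0 - P2 - P1 ^ 2) * Y1 + (24 : ℝ) * P1 ^ 2 * P4 * (Y0 - P2 - P1 ^ 2)
        + (16 : ℝ) * P1 ^ 2 * P3 * Y1 + (-8 : ℝ) * P1 ^ 2 * P3 * (Y0 - P2 - P1 ^ 2)
        + (-16 : ℝ) * P1 ^ 2 * P3 ^ 2 + (24 : ℝ) * P1 ^ 2 * P2 * W0 + (-96 : ℝ) * P1 ^ 2 * P2 * Y2
        + (24 : ℝ) * P1 ^ 2 * P2 * Y1 + (48 : ℝ) * P1 ^ 2 * P2 * P4 + (-16 : ℝ) * P1 ^ 2 * P2 * P3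
        + (-4 : ℝ) * (Y0 - P2 - P1 ^ 2) * Y1 ^ 2 + (16 : ℝ) * P3 * (Y0 - P2 - P1 ^ 2) * Y1
        + (-16 : ℝ) * P3 ^ 2 * (Y0 - P2 - P1 ^ 2) + (12 : ℝ) * P2 * Y1 ^ 2
        + (12 : ℝ) * P2 * (Y0 - P2 - P1 ^ 2) * W0 + (-48 : ℝ) * P2 * (Y0 - P2 - P1 ^ 2) * Y2
        + (12 : ℝ) * P2 * (Y0 - P2 - P1 ^ 2) * Y1 + (24 : ℝ) * P2 * P4 * (Y0 - P2 - P1 ^ 2)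
        + (16 : ℝ) * P2 * P3 * Y1 + (-8 : ℝ) * P2 * P3 * (Y0 - P2 - P1 ^ 2) + (-16 : ℝ) * P2 * P3 ^ 2
        + (12 : ℝ) * P2 ^ 2 * W0 + (-48 : ℝ) * P2 ^ 2 * Y2 + (12 : ℝ) * P2 ^ 2 * Y1 + (24 : ℝ) * P2 ^ 2 * P4
        + (-8 : ℝ) * P2 ^ 2 * P3) := by
    rw [hΩeq] at hΩ
    exact mul_pos hΩ hGpos
  rw [h1, h2, hΩeq]
  rw [hΩeq] at hid hΩ
  by_cases hA : 0 < P1 ^ 2 + P2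
  · have hApos : 0 < Y0 * (P1 ^ 2 + P2) := mul_pos hY0pos hA
    nlinarith [hid, hΩG, sq_nonneg (2 * (Y0 * (P1 ^ 2 + P2)) * ρ
          + (-2 * P1 ^ 3 * Y0 - 2 * P1 * Y0 ^ 2 + 2 * P1 * P2 * Y0 - 4 * P1 ^ 2 * Y1 - 4 * P1 ^ 2 * Y0 - 2 * Y0 * Y1
              + 4 * P3 * Y0 - 4 * P2 * Y1 - 4 * P2 * Y0))]
  · -- degenerate block `P1 = P2 = 0`: every mean vanishes, so every `π i = 0`, so `Y0 = 0` — contradicts `Y0 > 0`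
    exfalso
    have hP2z : P2 = 0 := by nlinarith [sq_nonneg P1]
    have hE0 : ∀ i, E i = 0 := by
      intro i
      have h := (Finset.sum_eq_zero_iff_of_nonneg (fun j _ => sq_nonneg (E j))).1 (by rw [← hP2]; exact hP2z) i (Finset.mem_univ i)
      exact pow_eq_zero_iff (n := 2) (by norm_num) |>.1 h
    have hπ0 : ∀ i, π i = 0 := by
      intro i
      obtain ⟨hπ, hα, _⟩ := hF i
      have hρ0 : 0 < ρ := by linarith
      have : ρ * π i ≤ 0 := by have := hE0 i; linarith
      nlinarith [mul_nonneg hρ0.le hπ]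
    have : Y0 = 0 := by rw [hY0]; exact Finset.sum_eq_zero (fun i _ => by rw [hπ0 i]; ring)
    linarith

end ZeroChangeState

end Summit.ValiantsHypothesis.ValiantsHypothesis.Theorems.LacunarySymmetroidMatrixDescartes
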